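import Summits.NavierStokesRegularity.NavierStokesRegularity.Theorems.ScenarioCensusRowF1ScalingTopFloors
import HarnessLib

/-!
# LINE 40 «scaling-top» port, part 4/4: §6 residual `SimilarCollapse` ≡ `Row_F1` (`similarLevel_spec`, `rowF1_of_similarCollapse`, `similarCollapse_iff_rowF1`), what the hypotheses admit
# (exactly self-similar / DSS / homogeneous profiles at full speed, the constant self-similar stream, the rest state); §7 summary; census KEYS `Row_F1sps` (the line's `Row_F1ss`;
# the census key `Row_F1ss` is «stretched-top»'s since slot 9) / `Row_F1ds` / `Row_F1hs` + `_excluded`, floors SSF / DSF / HF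

Re-homed for the scenario census (typer seat ns-census-typer-1 g10; the cells «similar-pocket snapshots» / F1ds / F1hs and the floors SSF / DSF / HF are MEMBERS OF RECORD «DECIDED IN
KERNEL IN FILES» of row F1 (item 85: critic idea-crit-3 g10 PASS no price tier B 12:32:22Z; ref PRE-CHECK ✓ §19.17; lead label); this port makes them TREE-decided): VERBATIM PORT of
ns-idea-3 LINE 40 «scaling-top», `pub/ideators/ns-idea-3/lines/scaling-top/line-scaling-top.lean` sha16 3435a148b4d1d87d (1360 l., lean check rc 0, 0 sorry), split for the 400-line
rule into `ScenarioCensusRowF1ScalingTop` (§1–§4a) → `…ScalingTopKill` (§4b) → `…ScalingTopFloors` (§5) → `…ScalingTopRows` (§6–§7 + census KEYS).  Lean text VERBATIM in namespace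
`…Theorems.ScenarioCensus.ScalingTop` (the line's `…Cruxes.ScenarioCensusRowF1.ScalingTopLine` re-homed); port edits: the frame restated VERBATIM by the line from LINES 34–39 (`topSet`,
`HasTypeIConstant`, `snapLevel`, `exists_fast_at`, `sqrt_mul_sq_mul`, `limitClass_compact`, `exists_level_of_limitKill`, `exists_witnessZoom_package`, `zoom_units`,
`eventually_forall_not_of_not_frequently`) is taken BY NAME from the landed two-time-top / one-level-top / snapshot-top / needle-top / echo-top ports, and the alias `centre_mem` is the tree's `IsTypeIAncientMild.comp_add_right` (Literature, BY NAME); the bookkeeping lemma `tendstoLocallyUniformly_comp_of_tendsto` (a twin of a landed lemma in a route-cone module) is not re-declared, its 3-line proof is inlined in `tendsto_eval`; `rowF1ss_holds` is spelled `: ScalingTop.Row_F1ss` (same statement; the unqualified text coincides with «stretched-top»'s `rowF1ss_holds`); `@[conjecture]` on the residual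
`SimilarCollapse` (≡ `ScenarioCensus.Row_F1`, OPEN); one-line docstrings added where missing (gate lint).  Statements untouched; the line's row keeps its name `ScalingTop.Row_F1ss`,
only its census KEY is spelled `Row_F1sps` because `ScenarioCensus.Row_F1ss` is «stretched-top»'s cell F1ss (slot 9, `ScenarioCensusRowF1StretchedTop.lean` :231).

No census VALUE is moved here (row F1 stays OPEN-WITH-LINE; the members become TREE-decided by name); NS regularity is NOT proved; `Row_F1` is untouched (zero
movement, `similarCollapse_iff_rowF1`); no summit statement is proved by this file. Lemmas that restate already-landed tree declarations are taken BY NAME (gate lint `dedup.landed`): `topSet` = `TwoTimeTop.topSet`, `HasTypeIConstant` = `OneLevelTop.HasTypeIConstant`, `snapLevel` = `SnapshotTop.snapLevel`, `exists_fast_at` = `SnapshotTop.exists_fast_at`, `sqrt_mul_sq_mul` = `SnapshotTop.sqrt_mul_sq_mul`, `limitClass_compact` = `NeedleTop.limitClass_compact`, `exists_level_of_limitKill` = `NeedleTop.exists_level_of_limitKill`, `zoom_units` = `NeedleTop.zoom_units`, `exists_witnessZoom_package` = `EchoTop.exists_witnessZoom_package`, `eventually_forall_not_of_not_frequently` = `EchoTop.eventually_forall_not_of_not_frequently`,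 `centre_mem` = `IsTypeIAncientMild.comp_add_right`.
-/

-- the summit and its single problem share the name `NavierStokesRegularity` (D-0017 nested layout)
set_option linter.dupNamespace false

noncomputable section

open MeasureTheory Set Function Filter TopologicalSpace Metric
open scoped Topology NNReal ENNReal InnerProductSpace

namespace Summit.NavierStokesRegularity.NavierStokesRegularity.Theorems.ScenarioCensus.ScalingTop

open Literature.Analysis Literature.Analysis.FluidPDE
open Summit.NavierStokesRegularity.NavierStokesRegularity.Theorems
open Summit.NavierStokesRegularity.NavierStokesRegularity.Theses
open Summit.NavierStokesRegularity.NavierStokesRegularity.Theorems.LocalHelicityTubeDoorFrobeniusProfileRigidityHelicalSlice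

/-! ## §6 The residual ≡ row F1 (declared); what the hypotheses admit (no smallness anywhere: exactly self-similar profiles at full
speed); summary -/

/-- The census-row threshold `rowLevel M l₁ l₂ A a := similarLevel M c_S l₁ l₂ A a`. -/
theorem similarLevel_spec {M l₁ l₂ A a : ℝ} (hl₁ : 0 < l₁) (hl : l₁ < l₂) (ha : 0 < a)
    (ν T : ℝ) (hν : 0 < ν) (hT : 0 < T) (u : ℝ → E3 → E3) (p : ℝ → E3 → ℝ)
    (hsol : IsClassicalNSSolutionOn (Ico 0 T) ν 0 u p) (hLH : IsLerayHopfOn T ν 0 (u 0) u)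
    (hdec : HasRapidSpatialDecay (u 0)) (hM : OneLevelTop.HasTypeIConstant ν T M u)
    (hfreq : ∃ᶠ t in 𝓝[<] T, ∀ x ∈ TwoTimeTop.topSet ν T u SnapshotTop.snapLevel t,
      SimilarPocketAt ν T u l₁ l₂ A a (similarLevel M SnapshotTop.snapLevel l₁ l₂ A a) t x) :
    HasSmoothExtensionPast ν 0 u T := by
  have h : 0 < SnapshotTop.snapLevel ∧ 0 < l₁ ∧ l₁ < l₂ ∧ 0 < a := ⟨SnapshotTop.snapLevel_pos, hl₁, hl, ha⟩
  have hspec := (Classical.choose_spec (similarFloor_holds M SnapshotTop.snapLevel l₁ l₂ A a h.1 h.2.1 h.2.2.1 h.2.2.2)).2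
    ν T hν hT u p hsol hLH hdec hM
  have hlev : similarLevel M SnapshotTop.snapLevel l₁ l₂ A a =
      Classical.choose (similarFloor_holds M SnapshotTop.snapLevel l₁ l₂ A a h.1 h.2.1 h.2.2.1 h.2.2.2) := by
    unfold similarLevel
    rw [dif_pos h]
  rw [hlev] at hfreq
  exact row_of_floor hν hT hsol hLH hdec hspec hfreq

/-- **Residual «SIMILAR COLLAPSE»** (maximal frame): every maximal Type-I Clay blow-up with constant `M` admits, for SOME admissible
`(l₁, l₂, A, a)`, similar pockets at the threshold `similarLevel M c_S l₁ l₂ A a` at every `c_S`-fast point along some `t_k ↑ T`.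
DECLARED ≡ row F1 (`similarCollapse_iff_rowF1`); no movement on `Row_F1` is claimed — after the floor its content is «there is no
Type-I Clay blow-up». -/
@[conjecture] def SimilarCollapse : Prop :=
  ∀ (ν T : ℝ), 0 < ν → 0 < T → ∀ (u : ℝ → E3 → E3) (p : ℝ → E3 → ℝ),
    IsMaximalSmoothSolution ν 0 u p T → IsLerayHopfOn T ν 0 (u 0) u → HasRapidSpatialDecay (u 0) →
    ∀ M : ℝ, OneLevelTop.HasTypeIConstant ν T M u →
      ∃ (l₁ l₂ A a : ℝ), 0 < l₁ ∧ l₁ < l₂ ∧ 0 < a ∧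
        ∃ᶠ t in 𝓝[<] T, ∀ x ∈ TwoTimeTop.topSet ν T u SnapshotTop.snapLevel t,
          SimilarPocketAt ν T u l₁ l₂ A a (similarLevel M SnapshotTop.snapLevel l₁ l₂ A a) t x

/-- **The split**: similar row (proved) + residual ⇒ row F1 (target BY NAME). -/
theorem rowF1_of_similarCollapse (hR : SimilarCollapse) : ScenarioCensus.Row_F1 := by
  unfold ScenarioCensus.Row_F1
  intro ν T hν hT u p hsol hLH hdec hTI
  by_contra hext
  obtain ⟨M, hM⟩ := OneLevelTop.exists_hasTypeIConstant hν hTI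
  obtain ⟨l₁, l₂, A, a, hl₁, hl, ha, hfreq⟩ := hR ν T hν hT u p ⟨hsol, hext⟩ hLH hdec M hM
  exact hext (similarLevel_spec hl₁ hl ha ν T hν hT u p hsol hLH hdec hM hfreq)

/-- The residual is a consequence of row F1 (vacuously). -/
theorem similarCollapse_of_rowF1 (h : ScenarioCensus.Row_F1) : SimilarCollapse :=
  fun ν T hν hT u p hmax hLH hdec _ hM =>
    (hmax.2 (h ν T hν hT u p hmax.1 hLH hdec hM.isTypeIBlowup)).elim

/-- The residual `SimilarCollapse` is EXACTLY `Row_F1`. -/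
theorem similarCollapse_iff_rowF1 : SimilarCollapse ↔ ScenarioCensus.Row_F1 :=
  ⟨rowF1_of_similarCollapse, similarCollapse_of_rowF1⟩

/-! ### What the scaling hypotheses admit (hypothesis level): NOTHING is asked to be small or slow.  A flow that is EXACTLY backward
self-similar about the apex `(T, x_*)` — `λ • u(T − λ²(T − t), x_* + λ z) = u(t, x_* + z)` for all `λ > 0` — has similar pockets AND DSS
windows of accuracy `0` for EVERY factor range / factor pair, and its fast points stay fast (the spatially constant profile
`u(t, y) = (T − t)^{−1/2} v` is the simplest instance: its whole space is `Λ`-fast as soon as `‖v‖ ≥ Λ√ν`); a snapshot that is exactly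
`(−1)`-homogeneous about `x_*` (Landau) has homogeneous pockets of accuracy `0`; the rest state satisfies all three trivially.  The content
of the floors is on the LIMIT side: the exact relations have NO non-trivial solution in `𝒦_M` (§4). -/

/-- Point bookkeeping: `x + ℓ•(b + w) = (x + ℓ•b) + ℓ•w`. -/
theorem apex_point (x b w : E3) (ℓ : ℝ) : x + ℓ • (b + w) = x + ℓ • b + ℓ • w := by
  rw [smul_add, add_assoc]

/-- An EXACTLY backward self-similar flow about the apex `(T, x + ℓb)` (`‖b‖ ≤ A`) has similar pockets of accuracy `0` for every factor
range `[l₁, l₂] ⊂ (0, ∞)` and every radius — at ANY speed. -/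
theorem similarPocketAt_of_selfSimilar {ν T : ℝ} {u : ℝ → E3 → E3} {l₁ l₂ A a t : ℝ} {x b : E3} (hl₁ : 0 < l₁) (hb : ‖b‖ ≤ A)
    (hss : ∀ lam : ℝ, 0 < lam → ∀ z : E3,
      lam • u (T - lam ^ 2 * (T - t)) (x + (Real.sqrt (ν * (T - t))) • b + lam • z)
        = u t (x + (Real.sqrt (ν * (T - t))) • b + z)) :
    SimilarPocketAt ν T u l₁ l₂ A a 0 t x := by
  refine ⟨b, hb, fun lam hlam w _ => ?_⟩
  have hl : 0 < lam := hl₁.trans_le hlam.1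
  have e := hss lam hl ((Real.sqrt (ν * (T - t))) • w)
  rw [smul_comm lam (Real.sqrt (ν * (T - t))) w, ← apex_point, ← apex_point] at e
  rw [e, sub_self, norm_zero, mul_zero, zero_mul]

/-- … and DSS windows of accuracy `0` for EVERY factor pair and depth. -/
theorem dssWindowAt_of_selfSimilar {ν T : ℝ} {u : ℝ → E3 → E3} {lam lam' K A a t : ℝ} {x b : E3} (hlam : 0 < lam)
    (hlam' : 0 < lam') (hb : ‖b‖ ≤ A)
    (hss : ∀ l : ℝ, 0 < l → ∀ τ : ℝ, ∀ z : E3,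
      l • u (T - l ^ 2 * (T - τ)) (x + (Real.sqrt (ν * (T - t))) • b + l • z)
        = u τ (x + (Real.sqrt (ν * (T - t))) • b + z)) :
    DssWindowAt ν T u lam lam' K A a 0 t x := by
  refine ⟨b, hb, fun τ _ w _ => ?_⟩
  have e := hss lam hlam τ ((Real.sqrt (ν * (T - t))) • w)
  have e' := hss lam' hlam' τ ((Real.sqrt (ν * (T - t))) • w)
  rw [smul_comm lam (Real.sqrt (ν * (T - t))) w, ← apex_point, ← apex_point] at e
  rw [smul_comm lam' (Real.sqrt (ν * (T - t))) w, ← apex_point, ← apex_point] at e'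
  rw [e, e', sub_self, norm_zero, mul_zero, zero_mul]
  exact ⟨le_rfl, le_rfl⟩

/-- A snapshot that is EXACTLY `(−1)`-homogeneous about `x + ℓb` over the dilation range has homogeneous pockets of accuracy `0`. -/
theorem homogeneousPocketAt_of_homogeneous {ν T : ℝ} {u : ℝ → E3 → E3} {μ₁ μ₂ A a t : ℝ} {x b : E3} (hb : ‖b‖ ≤ A)
    (hhom : ∀ μ ∈ Icc μ₁ μ₂, ∀ z : E3,
      μ • u t (x + (Real.sqrt (ν * (T - t))) • b + μ • z) = u t (x + (Real.sqrt (ν * (T - t))) • b + z)) :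
    HomogeneousPocketAt ν T u μ₁ μ₂ A a 0 t x := by
  refine ⟨b, hb, fun μ hμ w _ => ?_⟩
  have e := hhom μ hμ ((Real.sqrt (ν * (T - t))) • w)
  rw [smul_comm μ (Real.sqrt (ν * (T - t))) w, ← apex_point, ← apex_point] at e
  rw [e, sub_self, norm_zero, mul_zero, zero_mul]

/-- **The spatially constant self-similar profile** `u(t, y) = (√(T − t))⁻¹ • v` is exactly backward self-similar about every apex
`(T, x_*)`. -/
theorem constSS_selfSimilar (T : ℝ) (v : E3) {lam : ℝ} (τ : ℝ) (hlam : 0 < lam) :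
    lam • (Real.sqrt (T - (T - lam ^ 2 * (T - τ))))⁻¹ • v = (Real.sqrt (T - τ))⁻¹ • v := by
  have e : T - (T - lam ^ 2 * (T - τ)) = lam ^ 2 * (T - τ) := by ring
  rw [e, Real.sqrt_mul (sq_nonneg lam), Real.sqrt_sq hlam.le, smul_smul, mul_inv, ← mul_assoc, mul_inv_cancel₀ hlam.ne',
    one_mul]

/-- Its similar pockets have accuracy `0` (every factor range, apex reach `A ≥ 0`, radius, instant) … -/
theorem similarPocketAt_constSS {ν T t : ℝ} (v x : E3) {l₁ l₂ A a : ℝ} (hl₁ : 0 < l₁) (hA : 0 ≤ A) :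
    SimilarPocketAt ν T (fun t' (_ : E3) => (Real.sqrt (T - t'))⁻¹ • v) l₁ l₂ A a 0 t x :=
  similarPocketAt_of_selfSimilar (b := 0) hl₁ (by simpa using hA) fun lam hlam z => by
    beta_reduce
    exact constSS_selfSimilar T v t hlam

/-- … its DSS windows have accuracy `0` (every factor pair, every depth) … -/
theorem dssWindowAt_constSS {ν T t : ℝ} (v x : E3) {lam lam' K A a : ℝ} (hlam : 0 < lam) (hlam' : 0 < lam') (hA : 0 ≤ A) :
    DssWindowAt ν T (fun t' (_ : E3) => (Real.sqrt (T - t'))⁻¹ • v) lam lam' K A a 0 t x := by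
  refine ⟨0, by simpa using hA, fun τ _ w _ => ?_⟩
  beta_reduce
  rw [constSS_selfSimilar T v τ hlam, constSS_selfSimilar T v τ hlam', sub_self, norm_zero, mul_zero, zero_mul]
  exact ⟨le_rfl, le_rfl⟩

/-- … and its whole space is `Λ`-fast at every instant before `T` as soon as `‖v‖ ≥ Λ√ν`: the floors' hypotheses are met by fast points
(the content is in the conclusion, not in an empty top). -/
theorem constSS_fast {ν T t Λ : ℝ} (ht : t < T) {v : E3} (hv : Λ * Real.sqrt ν ≤ ‖v‖) (x : E3) :
    x ∈ TwoTimeTop.topSet ν T (fun t' (_ : E3) => (Real.sqrt (T - t'))⁻¹ • v) Λ t := by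
  have hpos : 0 < Real.sqrt (T - t) := Real.sqrt_pos.2 (sub_pos.2 ht)
  rw [TwoTimeTop.mem_topSet, norm_smul, norm_inv, Real.norm_eq_abs, abs_of_pos hpos, ← mul_assoc, mul_inv_cancel₀ hpos.ne', one_mul]
  exact hv

/-- The rest state has all three read-outs with accuracy `0` (and an empty top). -/
theorem scalingPockets_rest {ν T : ℝ} {l₁ l₂ lam lam' K μ₁ μ₂ A a t : ℝ} (hA : 0 ≤ A) (x : E3) :
    SimilarPocketAt ν T (fun _ _ => 0) l₁ l₂ A a 0 t x ∧ DssWindowAt ν T (fun _ _ => 0) lam lam' K A a 0 t x ∧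
      HomogeneousPocketAt ν T (fun _ _ => 0) μ₁ μ₂ A a 0 t x :=
  ⟨⟨0, by simpa using hA, fun _ _ _ _ => by simp⟩, ⟨0, by simpa using hA, fun _ _ _ _ => by simp⟩,
    ⟨0, by simpa using hA, fun _ _ _ _ => by simp⟩⟩

/-- Monotonicity of the similar read-out in the threshold. -/
theorem similarPocketAt_mono {ν T : ℝ} {u : ℝ → E3 → E3} {l₁ l₂ A a ε ε' t : ℝ} {x : E3} (hle : ε ≤ ε')
    (hν : 0 ≤ Real.sqrt ν) (h : SimilarPocketAt ν T u l₁ l₂ A a ε t x) : SimilarPocketAt ν T u l₁ l₂ A a ε' t x := by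
  obtain ⟨b, hb, hp⟩ := h
  exact ⟨b, hb, fun lam hlam w hw => (hp lam hlam w hw).trans (mul_le_mul_of_nonneg_right hle hν)⟩

/-! ## §7 Summary -/

/-- **LINE 40 «scaling-top», summary.**  In kernel, standard axioms: the three FLOORS (universal over fast points, every level `Λ`), the
three census ROWS, and the declared residual `SimilarCollapse ↔ Row_F1`. -/
theorem scalingTop_summary :
    SimilarFloor ∧ DssFloor ∧ HomogeneousFloor ∧ Row_F1ss ∧ Row_F1ds ∧ Row_F1hs ∧ (SimilarCollapse ↔ ScenarioCensus.Row_F1) :=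
  ⟨similarFloor_holds, dssFloor_holds, homogeneousFloor_holds, rowF1ss_holds, rowF1ds_holds, rowF1hs_holds,
    similarCollapse_iff_rowF1⟩

end Summit.NavierStokesRegularity.NavierStokesRegularity.Theorems.ScenarioCensus.ScalingTop

namespace Summit.NavierStokesRegularity.NavierStokesRegularity.Theorems.ScenarioCensus

/-! ## Census KEYS (ns `…Theorems.ScenarioCensus`): the SCALING members of row F1 (LINE 40) — TREE-decided F1sps (the line's `Row_F1ss`) / F1ds / F1hs and floors SSF / DSF / HF -/

/-- **Cell F1sps — SIMILAR-POCKET SNAPSHOTS** (the line's `Row_F1ss`; Type I with constant `M` · for `0 < l₁ < l₂`, along some `t_k ↑ T` every `c_S`-fast point `x` has an apex `x_* = x + ℓb`, `‖b‖ ≤ A`, and a pocket on which the snapshot is `ε`-SIMILAR to itself under all dilations `l ∈ [l₁, l₂]` about `x_*` ⇒ smooth extension past `T`): `:= ScalingTop.Row_F1ss`. (Census key spelled `F1sps`: `Row_F1ss` is «stretched-top»'s cell.) DECIDED. -/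
def Row_F1sps : Prop := ScalingTop.Row_F1ss
/-- F1sps is EXCLUDED (decided in the tree): `ScalingTop.rowF1ss_holds`. -/
theorem row_F1sps_excluded : Row_F1sps := ScalingTop.rowF1ss_holds

/-- **Cell F1ds — INCOMMENSURABLE DSS WINDOWS** (two discrete self-similarity factors `λ, λ′` with `log λ / log λ′` irrational on a backward parabolic window about an apex, at snapshots ⇒ extension): `:= ScalingTop.Row_F1ds`. DECIDED. -/
def Row_F1ds : Prop := ScalingTop.Row_F1ds
/-- F1ds is EXCLUDED (decided in the tree): `ScalingTop.rowF1ds_holds`. -/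
theorem row_F1ds_excluded : Row_F1ds := ScalingTop.rowF1ds_holds

/-- **Cell F1hs — HOMOGENEOUS SNAPSHOTS** (the snapshot is `ε`-homogeneous of degree `−1` about an apex under dilations `μ ∈ [μ₁, μ₂]`, at snapshots ⇒ extension): `:= ScalingTop.Row_F1hs`. DECIDED. -/
def Row_F1hs : Prop := ScalingTop.Row_F1hs
/-- F1hs is EXCLUDED (decided in the tree): `ScalingTop.rowF1hs_holds`. -/
theorem row_F1hs_excluded : Row_F1hs := ScalingTop.rowF1hs_holds

/-- **Floor SSF — the SIMILAR floor** (universal over fast points, every level; no maximality hypothesis): `ScalingTop.similarFloor_holds`. -/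
theorem row_F1_similarFloor : ScalingTop.SimilarFloor := ScalingTop.similarFloor_holds
/-- **Floor DSF — the DSS floor**: `ScalingTop.dssFloor_holds`. -/
theorem row_F1_dssFloor : ScalingTop.DssFloor := ScalingTop.dssFloor_holds
/-- **Floor HF (scaling) — the HOMOGENEOUS floor**: `ScalingTop.homogeneousFloor_holds`. -/
theorem row_F1_homogeneousFloor : ScalingTop.HomogeneousFloor := ScalingTop.homogeneousFloor_holds

end Summit.NavierStokesRegularity.NavierStokesRegularity.Theorems.ScenarioCensus

end
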